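import Summits.CriticalPhenomena.SAWScalingLimit.Theses.SAWPtolemyBoundary
import Literature.Probability.RandomPlanarGeometry.ConformalRectangleProofs

/-!
# Birth skeleton (BC3) for the crux `SAWPtolemyBoundary.BoundaryPtolemy`
(crux item stmt-CriticalPhenomena-15263, rank 2 of `route-CriticalPhenomena-SAWPtolemyBoundary`, sub-problem
`SAWScalingLimit`; skeleton registrar planner-skel-stmt-CriticalPhenomena-15263-0, 2026-08-17; tree path
`Summits/CriticalPhenomena/SAWScalingLimit/Cruxes/BoundaryPtolemy/Lines/birth.lean`.)

Crux (FIXED, by name): `BoundaryPtolemy` — there is ONE `p > 0` such that for every conformal rectangle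
`R = (Ω; a₀, a₁, a₂, a₃)` and every lattice approximation `q i δ ∈ Ω_δ` of the four marks (`δ·q i δ → aᵢ`,
pairwise joined in `Ω_δ` eventually) the two GERM-FREE CROSS-RATIOS of critical SAW partition functions
`Z_ij(δ) = (SAW.weight Ω δ (q i δ) (q j δ)) univ`,

  `CR₁(δ) = Z₀₂ Z₁₃ / (Z₀₁ Z₂₃)`,   `CR₂(δ) = Z₀₂ Z₁₃ / (Z₀₃ Z₁₂)`,

satisfy `CR₁^p → X₁`, `CR₂^p → X₂` (`δ → 0⁺`) with `X₁ + X₂ = 1` (Ptolemy's equality for the semi-metric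
`Z^{-p}` on `∂Ω`; conformal prediction `p = 1/(2b) = 4/5`, `b = 5/8`).

## The line: EXISTENCE → CONFORMAL MODULUS → EXACT 5-POINT COCYCLE → POWER LAW (4 registered stubs)

The route header's own foreseen split ("TWO-LAYER PLAN … BoundaryPtolemy ⇐ existence of cross-ratio limits
(ratio-limit / screening technology) → the value relation X₁ + X₂ = 1"), typed, with the value relation cut
further at the one place where it has a MECHANISM: once the limits are functions `f₁, f₂` of the conformal
modulus `η ∈ (0,1)` (Cardy's cross-ratio of a uniformizing datum, `Literature…crossRatio`,
well defined by the tree theorem `ConformalRectangle.crossRatio_eq_of_isUniformizing_holds`), the EXACT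
lattice identities between germ-free ratios of FIVE marked points,

  `CR₁(0123) = CR₁(0124) · CR₂(1234)`  (pure algebra of the ten `Z_ij`, every mesh),
  `CR₁(1230) = CR₂(0123)`              (cyclic relabelling + `Z_ij = Z_ji` by walk reversal),

pass to the limit as the functional equations `f₁(s(1-t)) = f₁(s) f₂(t)` and `f₂(η) = f₁(1-η)` on
`(0,1)` (because `η(0123) = η(0124)·(1 - η(1234))` and `η(1230) = 1 - η(0123)` are identities of
Cardy's cross-ratio, and every pair `(s,t) ∈ (0,1)²` is realised by five boundary points), whose continuous
`(0,1)`-valued solutions are exactly `f₁ = η^{2b}`, `f₂ = (1-η)^{2b}`, `b > 0` (multiplicative Cauchy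
equation).  Then `p = 1/(2b)` gives `X₁ = η`, `X₂ = 1 - η`, `X₁ + X₂ = 1`: Ptolemy, with the exponent as
OUTPUT (the route's `b` is not assumed; `b = 5/8` is the SLE₈⸝₃ prediction).

* (S1) `stub_crossRatioLimit` — `CrossRatioLimit` (OPEN; lattice, map-free; the "ratio-limit" half):
  the two germ-free cross-ratios converge, for every conformal rectangle and EVERY admissible approximation
  of its marks, to limits `F₁ R, F₂ R ∈ (0,1)` depending on the rectangle only (Kennedy–Lawler local
  boundary factors cancel index by index; existence for all approximations forces approximation-
  independence by interleaving, so nothing is lost by writing `F : ConformalRectangle → ℝ`).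
* (S2) `stub_conformalModulus` — `ConformalModulus` (OPEN; the conformal content, conditional on S1's
  conclusion): such limit functions factor CONTINUOUSLY through the conformal modulus:
  `Fᵢ R = fᵢ (crossRatio x)` for every uniformizing datum `(φ, x)` of `R`, `fᵢ` continuous `(0,1) → (0,1)`.
* (S3) `stub_scalingCocycle` — `ScalingCocycle` (L; PROVABLE: exact lattice algebra + sub-markings
  `MarkedDomain.restrictMarks` + realisability of moduli by marked discs + uniqueness of limits along
  `𝓝[>] 0`): scaling functions `f₁, f₂` that are crossing limits (`ConformalRectangle.HasCrossingLimit`) of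
  `CR₁, CR₂` for every admissible `(R, q)` satisfy the two functional equations above.
* (S4) `stub_powerLaw` — `PowerLaw` (M; PROVABLE NOW, pure real analysis): a continuous `f₁ : (0,1) → (0,1)`
  with `f₁(s(1-t)) = f₁(s) f₂(t)` and `f₂ = f₁(1 - ·)` is `η^{2b}` for one `b > 0`, and `f₂ = (1-η)^{2b}`.

Composition `BoundaryPtolemy_of : (S1) → (S2) → (S3) → (S4) → BoundaryPtolemy` (kernel-checked, sorry-free):
S1 gives `F`, S2 gives `f` (so `F` realises `HasCrossingLimit … f`), S3 the functional equations, S4 the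
exponent `b`; with `p := 1/(2b)` and a uniformizing datum of `R` (tree theorem
`MarkedDomain.exists_isUniformizing_holds`, modulus `η ∈ (0,1)` by `crossRatio_mem_Ioo_of_isUniformizing`),
`(F₁ R)^p = (η^{2b})^{1/(2b)} = η`, `(F₂ R)^p = 1 - η`, and `Filter.Tendsto.rpow_const` transports the two
limits of S1.  Every stub is used; no stub mentions the curve law, SLE, or the value `5/8`.

Why this cut: S1 is NECESSARY (the crux quantifies over all approximations, so it already asserts that the
germ-free limits exist); S2 isolates exactly the conformal input (a Cardy-type statement for a boundary
4-point observable of the SAW, with UNIDENTIFIED scaling functions — the shape a discrete-observable /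
screening argument would deliver); S3 + S4 explain WHY Ptolemy (and not another relation) must then hold and
make the exponent an output — they are the part of the crux that is provable today.  The only alternative
to S2 as a source of the value relation would be a map-free Ptolemy mechanism, which nobody has (route
header, WHY THIS LINE); a line through such a mechanism would be a different skeleton, not a reshaping of
this one.

Negatives honoured: no `Disproof.lean` exists for this crux (`ledger crux ls stmt-CriticalPhenomena-15263`:
no workfiles before this one); `ledger negatives --problem CriticalPhenomena` (11 entries, 2026-08-17): none
concerns boundary partition-function ratios; the only SAW-law entry is the all-`δ` tightness stmt-0772 — no
stub asserts tightness or any all-`δ` statement (everything is eventual in `δ` along `𝓝[>] 0`).  Barrier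
`ScaleCovarianceNotMoebius`: S2 is openly a conformal-invariance statement (not an upgrade from scale
covariance), flagged as the open conformal content; `EmbeddingModulusUniqueness`: on a sheared lattice S2
would hold with the sheared modulus — the square lattice's `D₄` symmetry is what makes Cardy's `η` the right
variable, and S2's prover must spend it.
-/

noncomputable section

open Filter Topology Set
open UpperHalfPlane (upperHalfPlaneSet)
open Literature.Probability.LatticeModels
open Literature.Probability.RandomPlanarGeometry

namespace Summit.CriticalPhenomena.SAWScalingLimit.Cruxes.BoundaryPtolemy.Birth

/-! ## 1. Local vocabulary (abbreviations of the crux's own sub-terms; tree declarations only) -/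

/-- `Z_ij(δ)`: the critical SAW partition function of `Ω_δ` between the lattice approximations of the
marks `i` and `j` — total mass of `SAW.weight`, as a real number (verbatim the crux's `Z_ij`). -/
def Z (R : ConformalRectangle) (q : Fin 4 → ℝ → Site 2) (δ : ℝ) (i j : Fin 4) : ℝ :=
  ((SAW.weight R.carrier δ (q i δ) (q j δ)) Set.univ).toReal

/-- First germ-free cross-ratio `CR₁(δ) = Z₀₂ Z₁₃ / (Z₀₁ Z₂₃)` (verbatim the crux's base of `X₁`). -/
def sawCR₁ (R : ConformalRectangle) (q : Fin 4 → ℝ → Site 2) (δ : ℝ) : ℝ :=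
  (Z R q δ 0 2 * Z R q δ 1 3) / (Z R q δ 0 1 * Z R q δ 2 3)

/-- Second germ-free cross-ratio `CR₂(δ) = Z₀₂ Z₁₃ / (Z₀₃ Z₁₂)` (verbatim the crux's base of `X₂`). -/
def sawCR₂ (R : ConformalRectangle) (q : Fin 4 → ℝ → Site 2) (δ : ℝ) : ℝ :=
  (Z R q δ 0 2 * Z R q δ 1 3) / (Z R q δ 0 3 * Z R q δ 1 2)

/-- Admissible lattice approximation of the four marks (verbatim the crux's two hypotheses):
`δ · q i δ → R.pt i` and the `q i δ` are pairwise joined in `Ω_δ` eventually, along `δ → 0⁺`. -/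
def IsMarkApprox (R : ConformalRectangle) (q : Fin 4 → ℝ → Site 2) : Prop :=
  (∀ i, Tendsto (fun δ => meshPoint δ (q i δ)) (𝓝[>] (0 : ℝ)) (𝓝 (R.pt i))) ∧
    ∀ i j, i ≠ j → ∀ᶠ δ in 𝓝[>] (0 : ℝ), (discreteDomainGraph R.carrier δ).Reachable (q i δ) (q j δ)

/-! ## 2. The four statements of the line -/

/-- **(S1) Existence of the germ-free cross-ratio limits** (`CrossRatioLimit`, map-free): there are
functions `F₁ F₂ : ConformalRectangle → (0,1)` such that for every conformal rectangle `R` and every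
admissible approximation `q` of its marks, `CR₁(δ) → F₁ R` and `CR₂(δ) → F₂ R` as `δ → 0⁺`. -/
def CrossRatioLimit : Prop :=
  ∃ F₁ F₂ : ConformalRectangle → ℝ,
    (∀ R, F₁ R ∈ Set.Ioo (0 : ℝ) 1 ∧ F₂ R ∈ Set.Ioo (0 : ℝ) 1) ∧
      ∀ (R : ConformalRectangle) (q : Fin 4 → ℝ → Site 2), IsMarkApprox R q →
        Tendsto (sawCR₁ R q) (𝓝[>] (0 : ℝ)) (𝓝 (F₁ R)) ∧
          Tendsto (sawCR₂ R q) (𝓝[>] (0 : ℝ)) (𝓝 (F₂ R))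

/-- **(S2) The limits factor continuously through the conformal modulus** (`ConformalModulus`): any
limit functions as in (S1) are of the form `Fᵢ R = fᵢ (crossRatio x)` for every uniformizing datum
`(φ, x)` of `R`, with `fᵢ : (0,1) → (0,1)` continuous. -/
def ConformalModulus : Prop :=
  ∀ F₁ F₂ : ConformalRectangle → ℝ,
    (∀ R, F₁ R ∈ Set.Ioo (0 : ℝ) 1 ∧ F₂ R ∈ Set.Ioo (0 : ℝ) 1) →
      (∀ (R : ConformalRectangle) (q : Fin 4 → ℝ → Site 2), IsMarkApprox R q →
          Tendsto (sawCR₁ R q) (𝓝[>] (0 : ℝ)) (𝓝 (F₁ R)) ∧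
            Tendsto (sawCR₂ R q) (𝓝[>] (0 : ℝ)) (𝓝 (F₂ R))) →
        ∃ f₁ f₂ : ℝ → ℝ, ContinuousOn f₁ (Set.Ioo 0 1) ∧ ContinuousOn f₂ (Set.Ioo 0 1) ∧
          (∀ η ∈ Set.Ioo (0 : ℝ) 1, f₁ η ∈ Set.Ioo (0 : ℝ) 1 ∧ f₂ η ∈ Set.Ioo (0 : ℝ) 1) ∧
            ∀ (R : ConformalRectangle) (φ : ConformalEquiv upperHalfPlaneSet R.carrier)
              (x : Fin 4 → ℝ), R.IsUniformizing φ x →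
              F₁ R = f₁ (crossRatio x) ∧ F₂ R = f₂ (crossRatio x)

/-- **(S3) The exact five-point cocycle and the cyclic relabelling pass to the limit**
(`ScalingCocycle`): scaling functions `f₁, f₂` that are the crossing limits of `CR₁, CR₂` for every
admissible `(R, q)` satisfy `f₁ (s(1-t)) = f₁ s · f₂ t` and `f₂ η = f₁ (1-η)` on `(0,1)`. -/
def ScalingCocycle : Prop :=
  ∀ f₁ f₂ : ℝ → ℝ,
    (∀ (R : ConformalRectangle) (q : Fin 4 → ℝ → Site 2), IsMarkApprox R q →
        R.HasCrossingLimit (sawCR₁ R q) f₁ ∧ R.HasCrossingLimit (sawCR₂ R q) f₂) →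
      (∀ s ∈ Set.Ioo (0 : ℝ) 1, ∀ t ∈ Set.Ioo (0 : ℝ) 1, f₁ (s * (1 - t)) = f₁ s * f₂ t) ∧
        ∀ η ∈ Set.Ioo (0 : ℝ) 1, f₂ η = f₁ (1 - η)

/-- **(S4) Continuous `(0,1)`-valued solutions of the cocycle are pure powers** (`PowerLaw`): if
`f₁ : (0,1) → (0,1)` is continuous, `f₁ (s(1-t)) = f₁ s · f₂ t` and `f₂ = f₁ (1 - ·)` on `(0,1)`, then
`f₁ η = η^{2b}` and `f₂ η = (1-η)^{2b}` for one `b > 0`. -/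
def PowerLaw : Prop :=
  ∀ f₁ f₂ : ℝ → ℝ, ContinuousOn f₁ (Set.Ioo 0 1) →
    (∀ η ∈ Set.Ioo (0 : ℝ) 1, f₁ η ∈ Set.Ioo (0 : ℝ) 1) →
      (∀ s ∈ Set.Ioo (0 : ℝ) 1, ∀ t ∈ Set.Ioo (0 : ℝ) 1, f₁ (s * (1 - t)) = f₁ s * f₂ t) →
        (∀ η ∈ Set.Ioo (0 : ℝ) 1, f₂ η = f₁ (1 - η)) →
          ∃ b : ℝ, 0 < b ∧ ∀ η ∈ Set.Ioo (0 : ℝ) 1, f₁ η = η ^ (2 * b) ∧ f₂ η = (1 - η) ^ (2 * b)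

/-! ### Name-keyed aliases of the four statements — the hypotheses of `BoundaryPtolemy_of`

The skeleton audit (`#h21_check_skeleton`) admits a hypothesis of the skeleton theorem only if its head
constant is a registered obligation or is NAMED like a declared stub; `__Registered.stub_X` is the statement
of `stub_X` under that name (device of `Cruxes/AxiomsOfLimit/Lines/birth.lean`,
`Cruxes/ModulusUniversality/Lines/birth.lean`).  Each alias is definitionally its statement. -/
namespace __Registered

/-- Alias of `CrossRatioLimit` keyed by the registered stub name. -/
abbrev stub_crossRatioLimit : Prop := CrossRatioLimit
/-- Alias of `ConformalModulus` keyed by the registered stub name. -/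
abbrev stub_conformalModulus : Prop := ConformalModulus
/-- Alias of `ScalingCocycle` keyed by the registered stub name. -/
abbrev stub_scalingCocycle : Prop := ScalingCocycle
/-- Alias of `PowerLaw` keyed by the registered stub name. -/
abbrev stub_powerLaw : Prop := PowerLaw

end __Registered

/-! ## 3. Registered stubs (`sorry` lives only here; statements LITERAL, so the registered signatures are
self-contained over §1 and the tree; the `example`s after each stub check it is literally its §2 statement) -/

/-- **STUB S1 (OPEN; lattice, map-free) — `CrossRatioLimit`, literal.**  Why plausibly true: Kennedy–Lawler
boundary scaling `Z_δ(aᵢ,aⱼ) ≈ c(aᵢ;δ) c(aⱼ;δ) H_Ω(aᵢ,aⱼ)` (KennedyLawler2013, arXiv:1109.3091, arXiv:1008.4321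
§3.1) in which every local factor `c(aᵢ;δ)` — lattice direction of `∂Ω` at `aᵢ`, corner angle, slow or
interior approach of `q i δ` — occurs once upstairs and once downstairs in each cross-ratio and cancels at
every mesh, leaving `H₀₂H₁₃/(H₀₁H₂₃) ∈ (0,1)` (diagonals are longer than sides); exact enumeration on
squares (route header, CHEAPEST FALSIFIER) is consistent.  Why it might fail / why it is not cheap: the
partner-independent FACTORISATION is itself the content (ratio-limit theorems for SAW generating functions
with different endpoints are not in print at `x = x_c`; Guttmann–Kennedy arXiv:1210.7924 only numerics); an
approximation-dependent limit would refute the crux itself.  Size: open problem. -/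
theorem stub_crossRatioLimit :
    ∃ F₁ F₂ : ConformalRectangle → ℝ,
      (∀ R, F₁ R ∈ Set.Ioo (0 : ℝ) 1 ∧ F₂ R ∈ Set.Ioo (0 : ℝ) 1) ∧
        ∀ (R : ConformalRectangle) (q : Fin 4 → ℝ → Site 2), IsMarkApprox R q →
          Tendsto (sawCR₁ R q) (𝓝[>] (0 : ℝ)) (𝓝 (F₁ R)) ∧
            Tendsto (sawCR₂ R q) (𝓝[>] (0 : ℝ)) (𝓝 (F₂ R)) := by
  sorry

example : CrossRatioLimit := stub_crossRatioLimit

/-- **STUB S2 (OPEN; the conformal content) — `ConformalModulus`, literal.**  Why plausibly true: the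
scaling limit of a boundary four-point observable of a critical planar model is expected to be conformally
invariant, hence a function of the one modulus `η` of `(Ω; a₀,…,a₃)`; for the SAW the prediction is
`f₁ = η^{5/4}`, `f₂ = (1-η)^{5/4}` (LSW boundary exponent `b = 5/8`, LawlerSchrammWerner2004SAW Prediction 5),
continuous.  Dilation/translation/`D₄` covariance of `F` is free (exact lattice symmetries + uniqueness of
limits); the content is invariance under the rest of the conformal group.  Why it might fail: this is a
Cardy-type theorem for the SAW — no discrete-holomorphic observable with full boundary control is known on
`ℤ²` (barrier `ParafermionicHalfCauchyRiemann` for that technique class); an exotic `ℤ²` limit with a second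
boundary modulus would satisfy S1 and violate S2.  Size: open problem (conditional on S1 it is strictly
weaker than conformal invariance of the SAW scaling limit). -/
theorem stub_conformalModulus :
    ∀ F₁ F₂ : ConformalRectangle → ℝ,
      (∀ R, F₁ R ∈ Set.Ioo (0 : ℝ) 1 ∧ F₂ R ∈ Set.Ioo (0 : ℝ) 1) →
        (∀ (R : ConformalRectangle) (q : Fin 4 → ℝ → Site 2), IsMarkApprox R q →
            Tendsto (sawCR₁ R q) (𝓝[>] (0 : ℝ)) (𝓝 (F₁ R)) ∧
              Tendsto (sawCR₂ R q) (𝓝[>] (0 : ℝ)) (𝓝 (F₂ R))) →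
          ∃ f₁ f₂ : ℝ → ℝ, ContinuousOn f₁ (Set.Ioo 0 1) ∧ ContinuousOn f₂ (Set.Ioo 0 1) ∧
            (∀ η ∈ Set.Ioo (0 : ℝ) 1, f₁ η ∈ Set.Ioo (0 : ℝ) 1 ∧ f₂ η ∈ Set.Ioo (0 : ℝ) 1) ∧
              ∀ (R : ConformalRectangle) (φ : ConformalEquiv upperHalfPlaneSet R.carrier)
                (x : Fin 4 → ℝ), R.IsUniformizing φ x →
                F₁ R = f₁ (crossRatio x) ∧ F₂ R = f₂ (crossRatio x) := by
  sorry

example : ConformalModulus := stub_conformalModulus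

/-- **STUB S3 (L; PROVABLE — exact lattice algebra + limit bookkeeping, but NOT one line) —
`ScalingCocycle`, literal.**  Content: (i) for a Jordan domain with FIVE marks and an admissible
approximation of them, the sub-rectangles `(0123), (0124), (1234)` (`MarkedDomain.restrictMarks`) inherit
admissible approximations and `CR₁(0123) = CR₁(0124)·CR₂(1234)` holds at every mesh at which the ten
`Z_ij` are positive (eventually, by reachability), so `HasCrossingLimit` + uniqueness of limits along the
`NeBot` filter `𝓝[>] 0` + ONE uniformizing datum of the 5-marked domain (`exists_isUniformizing_holds`,
restricted to sub-4-tuples) give `f₁(η(0123)) = f₁(η(0124)) f₂(η(1234))` with the algebraic identity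
`η(0123) = η(0124)(1 - η(1234))`; (ii) every `(s,t) ∈ (0,1)²` is `(η(0124), η(1234))` for some five marks
(half-plane computation with `x = (x₀, 0, 1, x₃, x₄)`), realised e.g. on the unit disc, which admits
admissible approximations; (iii) the cyclic relabelling `(1,2,3,0)` of a rectangle is a rectangle with
modulus `1 - η` whose `CR₁` is the old `CR₂` once `Z_ij = Z_ji` (walk reversal, cf.
`SupercriticalSAW.lawAt_map_sawReverse`).  Why it might fail: only through a junk-value slip (all `Z_ij > 0`
eventually is exactly the reachability clause of `IsMarkApprox`).  Size: L (disc approximations, 5-point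
uniformization bookkeeping, Möbius invariance of `crossRatio`). -/
theorem stub_scalingCocycle :
    ∀ f₁ f₂ : ℝ → ℝ,
      (∀ (R : ConformalRectangle) (q : Fin 4 → ℝ → Site 2), IsMarkApprox R q →
          R.HasCrossingLimit (sawCR₁ R q) f₁ ∧ R.HasCrossingLimit (sawCR₂ R q) f₂) →
        (∀ s ∈ Set.Ioo (0 : ℝ) 1, ∀ t ∈ Set.Ioo (0 : ℝ) 1, f₁ (s * (1 - t)) = f₁ s * f₂ t) ∧
          ∀ η ∈ Set.Ioo (0 : ℝ) 1, f₂ η = f₁ (1 - η) := by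
  sorry

example : ScalingCocycle := stub_scalingCocycle

/-- **STUB S4 (M; PROVABLE NOW, pure real analysis) — `PowerLaw`, literal.**  Content: the two relations
give `f₁ (s·u) = f₁ s · f₁ u` on `(0,1)`; `g σ := log f₁ (exp σ)` is additive and continuous on `(-∞,0)`
with `g < 0`, hence `g σ = a σ` with `a = -g(-1) > 0` (rational scaling `g(-m/n) = (m/n) g(-1)` + density +
continuity), i.e. `f₁ η = η^a`, then `f₂ η = f₁(1-η) = (1-η)^a`; take `b = a/2`.  Why it might fail: it
does not (a classical Cauchy–Pexider argument); the `(0,1)`-valuedness is what makes `b > 0`.  Size: M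
(Mathlib has no packaged "continuous multiplicative function on an interval is a power"). -/
theorem stub_powerLaw :
    ∀ f₁ f₂ : ℝ → ℝ, ContinuousOn f₁ (Set.Ioo 0 1) →
      (∀ η ∈ Set.Ioo (0 : ℝ) 1, f₁ η ∈ Set.Ioo (0 : ℝ) 1) →
        (∀ s ∈ Set.Ioo (0 : ℝ) 1, ∀ t ∈ Set.Ioo (0 : ℝ) 1, f₁ (s * (1 - t)) = f₁ s * f₂ t) →
          (∀ η ∈ Set.Ioo (0 : ℝ) 1, f₂ η = f₁ (1 - η)) →
            ∃ b : ℝ, 0 < b ∧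
              ∀ η ∈ Set.Ioo (0 : ℝ) 1, f₁ η = η ^ (2 * b) ∧ f₂ η = (1 - η) ^ (2 * b) := by
  sorry

example : PowerLaw := stub_powerLaw

/-! ## 4. The skeleton theorem: the four stubs imply the crux, BY NAME (kernel-checked, no `sorry` here) -/

/-- **`BoundaryPtolemy_of`: CrossRatioLimit → ConformalModulus → ScalingCocycle → PowerLaw →
`BoundaryPtolemy`.**  Glue: S1 gives the limit functions `F₁, F₂`; S2 the continuous scaling functions
`f₁, f₂` of the modulus with `Fᵢ R = fᵢ η_R`, so that `F` realises `R.HasCrossingLimit (sawCRᵢ R q) fᵢ`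
for every admissible `(R, q)`; S3 the two functional equations; S4 the exponent `b > 0`.  With
`p := 1/(2b)`: for an admissible `(R, q)` pick a uniformizing datum (`MarkedDomain.exists_isUniformizing_holds`),
`η := crossRatio x ∈ (0,1)` (`ConformalRectangle.crossRatio_mem_Ioo_of_isUniformizing`); then
`(F₁ R)^p = (η^{2b})^{1/(2b)} = η` and `(F₂ R)^p = 1 - η` (`Real.rpow_mul`), and `Filter.Tendsto.rpow_const`
turns `CRᵢ → Fᵢ R` into `CRᵢ^p → η`, resp. `1 - η`; `η + (1 - η) = 1`.  The crux's literal `fun δ => (…)^p`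
is `fun δ => sawCRᵢ R q δ ^ p` by `rfl`. -/
theorem BoundaryPtolemy_of (h₁ : __Registered.stub_crossRatioLimit)
    (h₂ : __Registered.stub_conformalModulus) (h₃ : __Registered.stub_scalingCocycle)
    (h₄ : __Registered.stub_powerLaw) :
    Summit.CriticalPhenomena.SAWScalingLimit.Theses.SAWPtolemyBoundary.BoundaryPtolemy := by
  obtain ⟨F₁, F₂, hF, hlim⟩ := h₁
  obtain ⟨f₁, f₂, hc₁, hc₂, hf, hFf⟩ := h₂ F₁ F₂ hF hlim
  -- `F` realises the crossing limits `f` (S1 + S2)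
  have hHCL : ∀ (R : ConformalRectangle) (q : Fin 4 → ℝ → Site 2), IsMarkApprox R q →
      R.HasCrossingLimit (sawCR₁ R q) f₁ ∧ R.HasCrossingLimit (sawCR₂ R q) f₂ := by
    intro R q hq
    obtain ⟨hT₁, hT₂⟩ := hlim R q hq
    refine ⟨fun φ x hφx => ?_, fun φ x hφx => ?_⟩
    · rw [← (hFf R φ x hφx).1]
      exact hT₁
    · rw [← (hFf R φ x hφx).2]
      exact hT₂
  -- S3: the functional equations; S4: the exponent
  obtain ⟨hcoc, hmir⟩ := h₃ f₁ f₂ hHCL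
  obtain ⟨b, hb, hpow⟩ := h₄ f₁ f₂ hc₁ (fun η hη => (hf η hη).1) hcoc hmir
  refine ⟨1 / (2 * b), by positivity, ?_⟩
  intro R q happrox hreach
  obtain ⟨hT₁, hT₂⟩ := hlim R q ⟨happrox, hreach⟩
  obtain ⟨φ, x, hφx⟩ := MarkedDomain.exists_isUniformizing_holds R
  have hη : crossRatio x ∈ Set.Ioo (0 : ℝ) 1 :=
    ConformalRectangle.crossRatio_mem_Ioo_of_isUniformizing hφx
  have hb2 : (2 : ℝ) * b ≠ 0 := by positivity
  have key₁ : F₁ R ^ (1 / (2 * b)) = crossRatio x := by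
    rw [(hFf R φ x hφx).1, (hpow _ hη).1, ← Real.rpow_mul hη.1.le, mul_one_div_cancel hb2,
      Real.rpow_one]
  have key₂ : F₂ R ^ (1 / (2 * b)) = 1 - crossRatio x := by
    rw [(hFf R φ x hφx).2, (hpow _ hη).2, ← Real.rpow_mul (sub_nonneg.2 hη.2.le),
      mul_one_div_cancel hb2, Real.rpow_one]
  refine ⟨crossRatio x, 1 - crossRatio x, by ring, ?_, ?_⟩
  · have h := hT₁.rpow_const (p := 1 / (2 * b)) (Or.inl (hF R).1.1.ne')
    rw [key₁] at h
    exact h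
  · have h := hT₂.rpow_const (p := 1 / (2 * b)) (Or.inl (hF R).2.1.ne')
    rw [key₂] at h
    exact h

/-- Wiring check (an `example`, so that `BoundaryPtolemy_of` stays the only theorem concluding the crux):
fed the four sorried stubs by name, the skeleton theorem proves the crux. -/
example : Summit.CriticalPhenomena.SAWScalingLimit.Theses.SAWPtolemyBoundary.BoundaryPtolemy :=
  BoundaryPtolemy_of stub_crossRatioLimit stub_conformalModulus stub_scalingCocycle stub_powerLaw

end Summit.CriticalPhenomena.SAWScalingLimit.Cruxes.BoundaryPtolemy.Birth

end
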